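/-
Copyright: statement-level skeleton of a published paper (lit-balaban cell, Phase-2 proof seat p20 gen 7). No proof claims
beyond what the kernel checks below.
-/
import Literature.MathematicalPhysics.QuantumFieldTheory.Balaban1983to89.B3CxiSecondDifferenceKernel
import Literature.MathematicalPhysics.QuantumFieldTheory.Balaban1983to89.B3CxiDerivativeBound

/-!
# B3 — T. Bałaban, *(Higgs)₂,₃ quantum fields in a finite volume. III. Renormalization*, CMP **88** (1983) 411–445
[Balaban1983Higgs3], (2.10) p. 426 / p. 437: the SECOND-ORDER member of *"the corresponding inequalities for derivatives"* for the
free propagator C^ξ = (−Δ^ξ+1)^{−1} on ξℤ³ — FILE 3/3: ASSEMBLY (d = 3),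
**|∂^ξ_{ν′}∂^ξ_νC^ξ(y)|, |∂^{ξ*}_{ν′}∂^ξ_νC^ξ(y)| ≤ 61000·e^{−½ξ|y|_∞}/(ξ|y|_∞)³** uniformly in 0 < ξ ≤ 1

statement-level skeleton of published theorems with citation tags; proofs where landed; nothing here is a claim about
the Yang–Mills mass gap

PDF held: `paper:balaban1983-higgs-2-3-quantum-fields-finite-volume` (journal page = PDF page + 410), p. 426 [PDF 16], p. 437 [PDF 27].
WHAT IS REPRODUCED: a member of rows **B3.Eq2.10** / **B3.Eq3.11-3.17** of `HOME/lit-balaban-r15/ROWS-B3.md` (reader/typer r15,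
fold owner of B3).  (2.10) p. 426 prints, for the propagators of the paper, *"|G(x,x′)| ≤ O(1)(L^jη)^{−1}d(x,x′)^{−1}e^{−δ₀d(x,x′)} …
for each differentiation ∂^η … an additional factor (L^jη)^{−1}d(x,x′)^{−1} appears on the right side"*, and p. 437 uses *"the
inequalities |C^ξ(y − y′)| ≦ O(1)e^{−½|y−y′|}/|y − y′| … and the corresponding inequalities for derivatives"*.  For the FREE
propagator C^ξ of the ξ-lattice (r15's `B3Sect3VectorSelfEnergy.Cxi 3 ξ y`, y ∈ ℤ³ the integer label of the point ξy; lattice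
derivatives `pdiffZ ξ⁻¹ ν` = ∂^ξ_ν, `pdiffAdjZ ξ⁻¹ ν` = ∂^{ξ*}_ν) the undifferentiated inequality is seat p39's
`B3CxiUniformBound.Cxi_three_le` (O(1) = 140) and the first-order one p39's `B3CxiDerivativeBound.abs_pdiffZ_Cxi_three_le_sup`
(|∂^ξ_νC^ξ(y)| ≤ 900·e^{−ξ|y|_∞/2}/(ξ|y|_∞)²).  THIS FILE PROVES THE SECOND-ORDER INEQUALITY with explicit constants, uniformly in the
lattice spacing: **for 0 < ξ ≤ 1, 0 ≠ y ∈ ℤ³, |y|_∞ = max_μ|y_μ|, all directions ν, ν′:**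
* `abs_Cxi_mixedDiff_le_sup` (ν ≠ ν′, unit steps c, c′ ∈ {±1} of either sign):
  |C^ξ(y+ce_ν+c′e_{ν′}) − C^ξ(y+ce_ν) − C^ξ(y+c′e_{ν′}) + C^ξ(y)| ≤ 61000·ξ⁻¹·e^{−ξ|y|_∞/2}/|y|_∞³;
* `abs_Cxi_pureDiff_le_sup`: |C^ξ(y+e_ν) − 2C^ξ(y) + C^ξ(y−e_ν)| ≤ 61000·ξ⁻¹·e^{−ξ|y|_∞/2}/|y|_∞³;
* hence `abs_pdiffZ_pdiffZ_Cxi_le_sup` (ν ≠ ν′) and `abs_pdiffAdjZ_pdiffZ_Cxi_le_sup` (all ν, ν′; on the diagonal this is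
  −∂^{ξ*}_ν∂^ξ_ν, the ν-th term of −Δ^ξ): **|(∂∂C^ξ)(y)| ≤ 61000·e^{−ξ|y|_∞/2}/(ξ|y|_∞)³** — (2.10)'s shape
  O(1)·d^{−1−2}e^{−δ₀d} with d = ξ|y|_∞ the physical sup distance and δ₀ = ½.
The paper prints no proof (it refers to the general estimates (2.10)–(2.12) of [13, 14]); the proof continues p39's heat-kernel
(Poissonization) method one order up: file 1 `B3CxiBesselSecondDifference` (tilted bound of the centred second difference of
the one-dimensional kernel G(s,n) = e^{−2s}-free Bessel function I_{|n|}(2s)), file 2 `B3CxiSecondDifferenceKernel` (pointwise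
bounds of the second-difference integrands: ≤ e^{−ξR/2}[592(θt)^{−5/2} + (160/7)N(θt)^{−3} + (512/49)N²(θt)^{−7/2}]e^{−(R²/14)/(θt)}
+ 96e^{−N}(2/√(1+θt))³, R² = Σ_μy_μ², N = |y|_∞, θ = (6+ξ²)^{−1}), and this file: (§1) the t-integrals ∫₀^∞u^{−p}e^{−q/u}du =
q^{1−p}Γ(p−1) for p = 3, 7/2 (p39's `integral_rpow_neg_exp_neg_div`; Γ(2) = 1, Γ(5/2) = 3√π/4), (§2) the integrated bound
`integral_abs_le_of_pointwise`, (§3) the assembly with both length scales kept apart (`abs_Cxi_mixedDiff_le_aux`,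
`abs_Cxi_pureDiff_le_aux`): with q = R²/14 and the prefactor θξ²ξ^{−3}·θ^{−1} = ξ^{−1},
|ΔΔC^ξ(y)| ≤ ξ^{−1}[e^{−ξR/2}(4144√(14π)/R³ + 4480N/R⁴ + 1536√(14π)N²/R⁵) + 1536e^{−N}], √(14π) ≤ 7; (§4) the sup-norm forms: R ≥ N ≥ 1
and N³e^{−N/2} ≤ 10.8 give the constant 29008 + 4480 + 10752 + 1536·10.8 ≤ 61000.  Mathlib + the cited tree files only; theorems
only, no new definitions, no named facts; standard axioms.  Unit `lit-balaban-p20-g7` (Phase-2 proof seat p20, gen 7), HOME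
`run/shared/lean/pub/lit-balaban/`, 2026-08-21.
-/

open scoped BigOperators Topology
open Real MeasureTheory Set Filter

namespace Literature.MathematicalPhysics.QuantumFieldTheory.Balaban1983to89.B3CxiSecondDifferenceBound

open B3Sect3VectorSelfEnergy B3CxiPropagator B3CxiBesselKernel B3CxiPoissonization B3CxiUniformBound B3CxiBesselDifference
  B3CxiDifferenceKernel B3CxiDerivativeBound B3CxiBesselSecondDifference B3CxiSecondDifferenceKernel

noncomputable section

variable {d : ℕ} {ξ : ℝ}

/-! ## 1. The t-integrals ∫₀^∞ u^{−3}e^{−q/u} du = q^{−2} and ∫₀^∞ u^{−7/2}e^{−q/u} du = q^{−5/2}·3√π/4 -/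

/-- kernel: θ = (6+ξ²)^{−1} > 0. [folklore] -/
private theorem theta3_pos (hξ : 0 < ξ) : 0 < hopWeight 3 ξ := by
  unfold hopWeight; positivity

/-- kernel: ∫₀^∞ u^{−3}e^{−q/u} du = (1/q)² (q > 0; Γ(2) = 1). [cite: Balaban1983Higgs3, (2.10) p.426] -/
theorem integral_rpow_neg_three_exp {q : ℝ} (hq : 0 < q) :
    IntegrableOn (fun u : ℝ => u ^ (-(3 : ℝ)) * Real.exp (-q / u)) (Ioi 0) ∧
    ∫ u in Ioi (0 : ℝ), u ^ (-(3 : ℝ)) * Real.exp (-q / u) = (1 / q) ^ 2 := by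
  obtain ⟨h1, h2⟩ := integral_rpow_neg_exp_neg_div (p := 3) (by norm_num) hq
  refine ⟨h1, ?_⟩
  rw [h2, show (3 : ℝ) - 1 = 1 + 1 by norm_num, Real.Gamma_add_one one_ne_zero, Real.Gamma_one, Real.rpow_add (by positivity),
    Real.rpow_one]
  ring

/-- kernel: ∫₀^∞ u^{−7/2}e^{−q/u} du = (1/q)^{5/2}·(3√π/4) (q > 0; Γ(5/2) = (3/2)(1/2)Γ(1/2) = 3√π/4). [cite: Balaban1983Higgs3, (2.10) p.426] -/
theorem integral_rpow_neg_seven_halves_exp {q : ℝ} (hq : 0 < q) :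
    IntegrableOn (fun u : ℝ => u ^ (-(7 / 2 : ℝ)) * Real.exp (-q / u)) (Ioi 0) ∧
    ∫ u in Ioi (0 : ℝ), u ^ (-(7 / 2 : ℝ)) * Real.exp (-q / u) = (1 / q) ^ (5 / 2 : ℝ) * (3 * Real.sqrt Real.pi / 4) := by
  obtain ⟨h1, h2⟩ := integral_rpow_neg_exp_neg_div (p := 7 / 2) (by norm_num) hq
  refine ⟨h1, ?_⟩
  rw [h2, show (7 / 2 : ℝ) - 1 = 5 / 2 by norm_num, show (5 / 2 : ℝ) = 3 / 2 + 1 by norm_num,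
    Real.Gamma_add_one (by norm_num), show (3 / 2 : ℝ) = 1 / 2 + 1 by norm_num, Real.Gamma_add_one (by norm_num),
    Real.Gamma_one_half_eq]
  ring

/-! ## 2. The t-integral of the pointwise bound of file 2 -/

/-- kernel (integrating the pointwise bound of `B3CxiSecondDifferenceKernel`): for 0 ≠ y ∈ ℤ³, μ₀ a largest coordinate,
q = R²/14, N = |y_{μ₀}|, θ = (6+ξ²)^{−1} and any f integrable on (0,∞) with |f(t)| ≤ e^{−ξR/2}[592(θt)^{−5/2} + (160/7)N(θt)^{−3} +
(512/49)N²(θt)^{−7/2}]e^{−q/(θt)} + 96e^{−N}(2/√(1+θt))³: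
∫₀^∞|f| ≤ e^{−ξR/2}·θ^{−1}[592q^{−3/2}√π/2 + (160/7)Nq^{−2} + (512/49)N²q^{−5/2}·3√π/4] + 96e^{−N}·16/θ. [cite: Balaban1983Higgs3, (2.10) p.426] -/
theorem integral_abs_le_of_pointwise (hξ : 0 < ξ) (y : ZSite 3) (hy : y ≠ 0) (μ₀ : Fin 3)
    (hmax : ∀ μ, (y μ).natAbs ≤ (y μ₀).natAbs) {f : ℝ → ℝ} (hf : IntegrableOn f (Ioi 0))
    (hpt : ∀ t ∈ Ioi (0 : ℝ), |f t| ≤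
      Real.exp (-(ξ * Real.sqrt (rsq y) / 2)) *
          ((592 * (hopWeight 3 ξ * t) ^ (-(5 / 2 : ℝ))
              + 160 / 7 * ((y μ₀).natAbs : ℝ) * (hopWeight 3 ξ * t) ^ (-(3 : ℝ))
              + 512 / 49 * ((y μ₀).natAbs : ℝ) ^ 2 * (hopWeight 3 ξ * t) ^ (-(7 / 2 : ℝ)))
            * Real.exp (-(rsq y / 14) / (hopWeight 3 ξ * t)))
        + 96 * Real.exp (-((y μ₀).natAbs : ℝ)) * (2 / Real.sqrt (1 + hopWeight 3 ξ * t)) ^ 3) :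
    ∫ t in Ioi (0 : ℝ), |f t| ≤
      Real.exp (-(ξ * Real.sqrt (rsq y) / 2)) *
          (592 * ((hopWeight 3 ξ)⁻¹ * ((1 / (rsq y / 14)) ^ (3 / 2 : ℝ) * (Real.sqrt Real.pi / 2)))
            + 160 / 7 * ((y μ₀).natAbs : ℝ) * ((hopWeight 3 ξ)⁻¹ * (1 / (rsq y / 14)) ^ 2)
            + 512 / 49 * ((y μ₀).natAbs : ℝ) ^ 2 *
              ((hopWeight 3 ξ)⁻¹ * ((1 / (rsq y / 14)) ^ (5 / 2 : ℝ) * (3 * Real.sqrt Real.pi / 4))))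
        + 96 * Real.exp (-((y μ₀).natAbs : ℝ)) * (16 / hopWeight 3 ξ) := by
  have hθ : 0 < hopWeight 3 ξ := theta3_pos hξ
  have hN1 : 1 ≤ ((y μ₀).natAbs : ℝ) := one_le_max y hy μ₀ hmax
  have hq : 0 < rsq y / 14 := by
    have h1 : (1 : ℝ) ≤ ((y μ₀).natAbs : ℝ) ^ 2 := by nlinarith
    linarith [sq_le_rsq y μ₀]
  obtain ⟨hgAint, hgAval⟩ := integral_rpow_neg_five_halves_exp hq
  obtain ⟨hgBint, hgBval⟩ := integral_rpow_neg_three_exp hq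
  obtain ⟨hgCint, hgCval⟩ := integral_rpow_neg_seven_halves_exp hq
  obtain ⟨hPint, hPval⟩ := integral_pref hθ
  set gA : ℝ → ℝ := fun u => u ^ (-(5 / 2 : ℝ)) * Real.exp (-(rsq y / 14) / u) with hgA
  set gB : ℝ → ℝ := fun u => u ^ (-(3 : ℝ)) * Real.exp (-(rsq y / 14) / u) with hgB
  set gC : ℝ → ℝ := fun u => u ^ (-(7 / 2 : ℝ)) * Real.exp (-(rsq y / 14) / u) with hgC
  have hscale_int : ∀ g : ℝ → ℝ, IntegrableOn g (Ioi 0) → IntegrableOn (fun t => g (hopWeight 3 ξ * t)) (Ioi 0) := by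
    intro g hg
    have h := (integrableOn_Ioi_comp_mul_left_iff g 0 hθ).mpr
    rw [mul_zero] at h
    exact h hg
  have hscale_val : ∀ g : ℝ → ℝ, ∫ t in Ioi (0 : ℝ), g (hopWeight 3 ξ * t) = (hopWeight 3 ξ)⁻¹ * ∫ u in Ioi (0 : ℝ), g u := by
    intro g
    have h := integral_comp_mul_left_Ioi g 0 hθ
    rw [mul_zero, smul_eq_mul] at h
    exact h
  have hAint := hscale_int gA hgAint
  have hBint := hscale_int gB hgBint
  have hCint := hscale_int gC hgCint
  have hAval : ∫ t in Ioi (0 : ℝ), gA (hopWeight 3 ξ * t) = (hopWeight 3 ξ)⁻¹ * ((1 / (rsq y / 14)) ^ (3 / 2 : ℝ) * (Real.sqrt Real.pi / 2)) := by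
    rw [hscale_val gA, hgAval]
  have hBval : ∫ t in Ioi (0 : ℝ), gB (hopWeight 3 ξ * t) = (hopWeight 3 ξ)⁻¹ * (1 / (rsq y / 14)) ^ 2 := by
    rw [hscale_val gB, hgBval]
  have hCval : ∫ t in Ioi (0 : ℝ), gC (hopWeight 3 ξ * t) =
      (hopWeight 3 ξ)⁻¹ * ((1 / (rsq y / 14)) ^ (5 / 2 : ℝ) * (3 * Real.sqrt Real.pi / 4)) := by
    rw [hscale_val gC, hgCval]
  set E1 : ℝ := Real.exp (-(ξ * Real.sqrt (rsq y) / 2)) with hE1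
  set N : ℝ := ((y μ₀).natAbs : ℝ) with hN
  set EN : ℝ := Real.exp (-((y μ₀).natAbs : ℝ)) with hEN
  have hpt' : ∀ t ∈ Ioi (0 : ℝ), |f t| ≤
      E1 * (592 * gA (hopWeight 3 ξ * t) + 160 / 7 * N * gB (hopWeight 3 ξ * t) + 512 / 49 * N ^ 2 * gC (hopWeight 3 ξ * t))
        + 96 * EN * (2 / Real.sqrt (1 + hopWeight 3 ξ * t)) ^ 3 := by
    intro t ht
    refine (hpt t ht).trans_eq ?_
    simp only [hgA, hgB, hgC]
    ring
  have hAB : IntegrableOn (fun t => 592 * gA (hopWeight 3 ξ * t) + 160 / 7 * N * gB (hopWeight 3 ξ * t)) (Ioi 0) :=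
    (hAint.const_mul 592).add (hBint.const_mul (160 / 7 * N))
  have hABC : IntegrableOn (fun t => 592 * gA (hopWeight 3 ξ * t) + 160 / 7 * N * gB (hopWeight 3 ξ * t)
      + 512 / 49 * N ^ 2 * gC (hopWeight 3 ξ * t)) (Ioi 0) :=
    hAB.add (hCint.const_mul (512 / 49 * N ^ 2))
  have hI1 : IntegrableOn (fun t => E1 * (592 * gA (hopWeight 3 ξ * t) + 160 / 7 * N * gB (hopWeight 3 ξ * t)
      + 512 / 49 * N ^ 2 * gC (hopWeight 3 ξ * t))) (Ioi 0) :=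
    Integrable.const_mul hABC _
  have hI2 : IntegrableOn (fun t => 96 * EN * (2 / Real.sqrt (1 + hopWeight 3 ξ * t)) ^ 3) (Ioi 0) :=
    Integrable.const_mul hPint _
  calc ∫ t in Ioi (0 : ℝ), |f t|
      ≤ ∫ t in Ioi (0 : ℝ), (E1 * (592 * gA (hopWeight 3 ξ * t) + 160 / 7 * N * gB (hopWeight 3 ξ * t)
          + 512 / 49 * N ^ 2 * gC (hopWeight 3 ξ * t)) + 96 * EN * (2 / Real.sqrt (1 + hopWeight 3 ξ * t)) ^ 3) :=
        setIntegral_mono_on hf.abs (hI1.add hI2) measurableSet_Ioi hpt'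
    _ = _ := by
        rw [integral_add hI1 hI2, integral_const_mul, integral_const_mul,
          integral_add hAB (hCint.const_mul (512 / 49 * N ^ 2)),
          integral_add (hAint.const_mul 592) (hBint.const_mul (160 / 7 * N)),
          integral_const_mul, integral_const_mul, integral_const_mul, hAval, hBval, hCval, hPval]

/-! ## 3. Assembly with the two length scales R = (Σ_μ y_μ²)^{1/2} and N = |y|_∞ kept apart -/

/-- kernel: √14·√π ≤ 7. [folklore] -/
private theorem sqrt_fourteen_mul_sqrt_pi_le : Real.sqrt 14 * Real.sqrt Real.pi ≤ 7 := by
  rw [← Real.sqrt_mul (by norm_num)]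
  calc Real.sqrt (14 * Real.pi) ≤ Real.sqrt (7 ^ 2) := Real.sqrt_le_sqrt (by nlinarith [Real.pi_lt_d2])
    _ = 7 := Real.sqrt_sq (by norm_num)

/-- kernel (from the integral representation to the two-scale bound): if D = θξ²ξ^{−3}∫₀^∞f with f as in
`integral_abs_le_of_pointwise`, then |D| ≤ ξ^{−1}·[e^{−ξR/2}(29008/(R·R²) + 4480N/(R²)² + 10752N²/(R·(R²)²)) + 1536e^{−N}]
(R² = `rsq y`, R = √R², N = |y_{μ₀}|; (14/R²)^{3/2} = (14/R²)(√14/R), (14/R²)^{5/2} = (14/R²)²(√14/R), √14·√π ≤ 7).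
[cite: Balaban1983Higgs3, (2.10) p.426] -/
theorem abs_le_of_integral_repr (hξ : 0 < ξ) (y : ZSite 3) (hy : y ≠ 0) (μ₀ : Fin 3)
    (hmax : ∀ μ, (y μ).natAbs ≤ (y μ₀).natAbs) {f : ℝ → ℝ} (hf : IntegrableOn f (Ioi 0))
    (hpt : ∀ t ∈ Ioi (0 : ℝ), |f t| ≤
      Real.exp (-(ξ * Real.sqrt (rsq y) / 2)) *
          ((592 * (hopWeight 3 ξ * t) ^ (-(5 / 2 : ℝ))
              + 160 / 7 * ((y μ₀).natAbs : ℝ) * (hopWeight 3 ξ * t) ^ (-(3 : ℝ))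
              + 512 / 49 * ((y μ₀).natAbs : ℝ) ^ 2 * (hopWeight 3 ξ * t) ^ (-(7 / 2 : ℝ)))
            * Real.exp (-(rsq y / 14) / (hopWeight 3 ξ * t)))
        + 96 * Real.exp (-((y μ₀).natAbs : ℝ)) * (2 / Real.sqrt (1 + hopWeight 3 ξ * t)) ^ 3)
    {D : ℝ} (hD : D = hopWeight 3 ξ * ξ ^ 2 * ξ⁻¹ ^ 3 * ∫ t in Ioi (0 : ℝ), f t) :
    |D| ≤ ξ⁻¹ * (Real.exp (-(ξ * Real.sqrt (rsq y) / 2)) *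
        (29008 / (Real.sqrt (rsq y) * rsq y) + 4480 * ((y μ₀).natAbs : ℝ) / (rsq y) ^ 2
          + 10752 * ((y μ₀).natAbs : ℝ) ^ 2 / (Real.sqrt (rsq y) * (rsq y) ^ 2))
      + 1536 * Real.exp (-((y μ₀).natAbs : ℝ))) := by
  have hθ : 0 < hopWeight 3 ξ := theta3_pos hξ
  have hθ' := hθ.ne'
  have hξ' := hξ.ne'
  have hN1 : 1 ≤ ((y μ₀).natAbs : ℝ) := one_le_max y hy μ₀ hmax
  have hrsq : 0 < rsq y := by nlinarith [sq_le_rsq y μ₀]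
  have hRpos : 0 < Real.sqrt (rsq y) := Real.sqrt_pos.mpr hrsq
  have hR' := hRpos.ne'
  have hn : 0 ≤ ((y μ₀).natAbs : ℝ) := Nat.cast_nonneg _
  have hI := integral_abs_le_of_pointwise hξ y hy μ₀ hmax hf hpt
  have hc : 0 ≤ hopWeight 3 ξ * ξ ^ 2 * ξ⁻¹ ^ 3 := by positivity
  have habs : |D| ≤ hopWeight 3 ξ * ξ ^ 2 * ξ⁻¹ ^ 3 * ∫ t in Ioi (0 : ℝ), |f t| := by
    rw [hD, abs_mul, abs_of_nonneg hc]
    exact mul_le_mul_of_nonneg_left (abs_integral_le_integral_abs (μ := volume.restrict (Ioi (0 : ℝ))) (f := f)) hc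
  refine habs.trans ((mul_le_mul_of_nonneg_left hI hc).trans ?_)
  -- simplify the constants
  have hq14 : 1 / (rsq y / 14) = 14 / rsq y := by rw [one_div, inv_div]
  have hq32 : (14 / rsq y) ^ (3 / 2 : ℝ) = 14 / rsq y * (Real.sqrt 14 / Real.sqrt (rsq y)) := by
    rw [show (3 / 2 : ℝ) = 1 + 1 / 2 by norm_num, Real.rpow_add (by positivity), Real.rpow_one,
      ← Real.sqrt_eq_rpow, Real.sqrt_div' _ (rsq_nonneg y)]
  have hq52 : (14 / rsq y) ^ (5 / 2 : ℝ) = (14 / rsq y) ^ 2 * (Real.sqrt 14 / Real.sqrt (rsq y)) := by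
    rw [show (5 / 2 : ℝ) = 2 + 1 / 2 by norm_num, Real.rpow_add (by positivity), Real.rpow_two,
      ← Real.sqrt_eq_rpow, Real.sqrt_div' _ (rsq_nonneg y)]
  have hsqpi : Real.sqrt 14 * Real.sqrt Real.pi ≤ 7 := sqrt_fourteen_mul_sqrt_pi_le
  have hsqpi0 : 0 ≤ Real.sqrt 14 * Real.sqrt Real.pi := by positivity
  rw [hq14, hq32, hq52]
  have e1 : hopWeight 3 ξ * ξ ^ 2 * ξ⁻¹ ^ 3 *
      (Real.exp (-(ξ * Real.sqrt (rsq y) / 2)) *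
          (592 * ((hopWeight 3 ξ)⁻¹ * (14 / rsq y * (Real.sqrt 14 / Real.sqrt (rsq y)) * (Real.sqrt Real.pi / 2)))
            + 160 / 7 * ((y μ₀).natAbs : ℝ) * ((hopWeight 3 ξ)⁻¹ * (14 / rsq y) ^ 2)
            + 512 / 49 * ((y μ₀).natAbs : ℝ) ^ 2 *
              ((hopWeight 3 ξ)⁻¹ * ((14 / rsq y) ^ 2 * (Real.sqrt 14 / Real.sqrt (rsq y)) * (3 * Real.sqrt Real.pi / 4))))
        + 96 * Real.exp (-((y μ₀).natAbs : ℝ)) * (16 / hopWeight 3 ξ))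
      = ξ⁻¹ * (Real.exp (-(ξ * Real.sqrt (rsq y) / 2)) *
          (4144 * (Real.sqrt 14 * Real.sqrt Real.pi) / (Real.sqrt (rsq y) * rsq y)
            + 4480 * ((y μ₀).natAbs : ℝ) / (rsq y) ^ 2
            + 1536 * (Real.sqrt 14 * Real.sqrt Real.pi) * ((y μ₀).natAbs : ℝ) ^ 2 / (Real.sqrt (rsq y) * (rsq y) ^ 2))
        + 1536 * Real.exp (-((y μ₀).natAbs : ℝ))) := by
    field_simp
    ring
  rw [e1]
  have hden1 : 0 < Real.sqrt (rsq y) * rsq y := mul_pos hRpos hrsq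
  have hden2 : 0 < Real.sqrt (rsq y) * (rsq y) ^ 2 := by positivity
  have hA : 4144 * (Real.sqrt 14 * Real.sqrt Real.pi) / (Real.sqrt (rsq y) * rsq y) ≤ 29008 / (Real.sqrt (rsq y) * rsq y) :=
    div_le_div_of_nonneg_right (by nlinarith) hden1.le
  have hC : 1536 * (Real.sqrt 14 * Real.sqrt Real.pi) * ((y μ₀).natAbs : ℝ) ^ 2 / (Real.sqrt (rsq y) * (rsq y) ^ 2) ≤
      10752 * ((y μ₀).natAbs : ℝ) ^ 2 / (Real.sqrt (rsq y) * (rsq y) ^ 2) :=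
    div_le_div_of_nonneg_right (by nlinarith [sq_nonneg ((y μ₀).natAbs : ℝ)]) hden2.le
  have hE : 0 ≤ Real.exp (-(ξ * Real.sqrt (rsq y) / 2)) := (Real.exp_pos _).le
  refine mul_le_mul_of_nonneg_left (add_le_add (mul_le_mul_of_nonneg_left ?_ hE) le_rfl) (inv_pos.mpr hξ).le
  linarith

/-- kernel: C^ξ at four shifted points as ONE t-integral: C^ξ(y+ce_ν+c′e_{ν′}) − C^ξ(y+ce_ν) − C^ξ(y+c′e_{ν′}) + C^ξ(y) =
θξ²ξ^{−3}∫₀^∞(the mixed second difference of the integrands). [cite: Balaban1983Higgs3, (2.10) p.426] -/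
theorem Cxi_mixedDiff_eq_integral (hξ : 0 < ξ) (y : ZSite 3) (ν ν' : Fin 3) (c c' : ℤ) :
    Cxi 3 ξ (y + c • unitVec ν + c' • unitVec ν') - Cxi 3 ξ (y + c • unitVec ν) - Cxi 3 ξ (y + c' • unitVec ν') + Cxi 3 ξ y =
      hopWeight 3 ξ * ξ ^ 2 * ξ⁻¹ ^ 3 * ∫ t in Ioi (0 : ℝ),
        (integrand 3 ξ (y + c • unitVec ν + c' • unitVec ν') t - integrand 3 ξ (y + c • unitVec ν) t
          - integrand 3 ξ (y + c' • unitVec ν') t + integrand 3 ξ y t) := by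
  have ha := integrableOn_integrand hξ (y + c • unitVec ν + c' • unitVec ν')
  have hb := integrableOn_integrand hξ (y + c • unitVec ν)
  have hc := integrableOn_integrand hξ (y + c' • unitVec ν')
  have hd := integrableOn_integrand hξ y
  have hab : IntegrableOn (fun t => integrand 3 ξ (y + c • unitVec ν + c' • unitVec ν') t
      - integrand 3 ξ (y + c • unitVec ν) t) (Ioi 0) := ha.sub hb
  have habc : IntegrableOn (fun t => integrand 3 ξ (y + c • unitVec ν + c' • unitVec ν') t
      - integrand 3 ξ (y + c • unitVec ν) t - integrand 3 ξ (y + c' • unitVec ν') t) (Ioi 0) := hab.sub hc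
  rw [Cxi_eq_poissonK hξ, Cxi_eq_poissonK hξ, Cxi_eq_poissonK hξ, Cxi_eq_poissonK hξ]
  unfold poissonK
  rw [integral_add habc hd, integral_sub hab hc, integral_sub ha hb]
  ring

/-- kernel: C^ξ(y+e_ν) − 2C^ξ(y) + C^ξ(y−e_ν) = θξ²ξ^{−3}∫₀^∞(the pure second difference of the integrands). [cite: Balaban1983Higgs3, (2.10) p.426] -/
theorem Cxi_pureDiff_eq_integral (hξ : 0 < ξ) (y : ZSite 3) (ν : Fin 3) :
    Cxi 3 ξ (y + unitVec ν) - 2 * Cxi 3 ξ y + Cxi 3 ξ (y - unitVec ν) =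
      hopWeight 3 ξ * ξ ^ 2 * ξ⁻¹ ^ 3 * ∫ t in Ioi (0 : ℝ),
        (integrand 3 ξ (y + unitVec ν) t - 2 * integrand 3 ξ y t + integrand 3 ξ (y - unitVec ν) t) := by
  have ha := integrableOn_integrand hξ (y + unitVec ν)
  have hb := integrableOn_integrand hξ y
  have hc := integrableOn_integrand hξ (y - unitVec ν)
  have hab : IntegrableOn (fun t => integrand 3 ξ (y + unitVec ν) t - 2 * integrand 3 ξ y t) (Ioi 0) :=
    ha.sub (hb.const_mul 2)
  rw [Cxi_eq_poissonK hξ, Cxi_eq_poissonK hξ, Cxi_eq_poissonK hξ]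
  unfold poissonK
  rw [integral_add hab hc, integral_sub ha (hb.const_mul 2), integral_const_mul]
  ring

/-- **The mixed second difference of C^ξ, two-scale form**: for 0 < ξ, 0 ≠ y ∈ ℤ³, μ₀ a largest coordinate, ν ≠ ν′ and unit steps
c, c′ ∈ {±1}, with R² = Σ_μy_μ², R = √R², N = |y_{μ₀}|:
|C^ξ(y+ce_ν+c′e_{ν′}) − C^ξ(y+ce_ν) − C^ξ(y+c′e_{ν′}) + C^ξ(y)| ≤ ξ^{−1}[e^{−ξR/2}(29008/(R·R²) + 4480N/R⁴ + 10752N²/(R·R⁴)) + 1536e^{−N}].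
[cite: Balaban1983Higgs3, (2.10) p.426] -/
theorem abs_Cxi_mixedDiff_le_aux (hξ : 0 < ξ) (y : ZSite 3) (hy : y ≠ 0) {ν ν' : Fin 3} (hne : ν ≠ ν') {c c' : ℤ}
    (hc : c = 1 ∨ c = -1) (hc' : c' = 1 ∨ c' = -1) (μ₀ : Fin 3) (hmax : ∀ μ, (y μ).natAbs ≤ (y μ₀).natAbs) :
    |Cxi 3 ξ (y + c • unitVec ν + c' • unitVec ν') - Cxi 3 ξ (y + c • unitVec ν) - Cxi 3 ξ (y + c' • unitVec ν') + Cxi 3 ξ y| ≤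
      ξ⁻¹ * (Real.exp (-(ξ * Real.sqrt (rsq y) / 2)) *
          (29008 / (Real.sqrt (rsq y) * rsq y) + 4480 * ((y μ₀).natAbs : ℝ) / (rsq y) ^ 2
            + 10752 * ((y μ₀).natAbs : ℝ) ^ 2 / (Real.sqrt (rsq y) * (rsq y) ^ 2))
        + 1536 * Real.exp (-((y μ₀).natAbs : ℝ))) :=
  abs_le_of_integral_repr hξ y hy μ₀ hmax
    ((((integrableOn_integrand hξ _).sub (integrableOn_integrand hξ _)).sub (integrableOn_integrand hξ _)).add
      (integrableOn_integrand hξ _))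
    (fun _ ht => abs_integrand_mixedDiff_three_le hξ y hne hc hc' μ₀ hmax ht)
    (Cxi_mixedDiff_eq_integral hξ y ν ν' c c')

/-- **The pure second difference of C^ξ, two-scale form**: for 0 < ξ, 0 ≠ y ∈ ℤ³, μ₀ a largest coordinate and any ν,
|C^ξ(y+e_ν) − 2C^ξ(y) + C^ξ(y−e_ν)| ≤ ξ^{−1}[e^{−ξR/2}(29008/(R·R²) + 4480N/R⁴ + 10752N²/(R·R⁴)) + 1536e^{−N}]. [cite: Balaban1983Higgs3, (2.10) p.426] -/
theorem abs_Cxi_pureDiff_le_aux (hξ : 0 < ξ) (y : ZSite 3) (hy : y ≠ 0) (ν μ₀ : Fin 3)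
    (hmax : ∀ μ, (y μ).natAbs ≤ (y μ₀).natAbs) :
    |Cxi 3 ξ (y + unitVec ν) - 2 * Cxi 3 ξ y + Cxi 3 ξ (y - unitVec ν)| ≤
      ξ⁻¹ * (Real.exp (-(ξ * Real.sqrt (rsq y) / 2)) *
          (29008 / (Real.sqrt (rsq y) * rsq y) + 4480 * ((y μ₀).natAbs : ℝ) / (rsq y) ^ 2
            + 10752 * ((y μ₀).natAbs : ℝ) ^ 2 / (Real.sqrt (rsq y) * (rsq y) ^ 2))
        + 1536 * Real.exp (-((y μ₀).natAbs : ℝ))) :=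
  abs_le_of_integral_repr hξ y hy μ₀ hmax
    (((integrableOn_integrand hξ _).sub ((integrableOn_integrand hξ _).const_mul 2)).add (integrableOn_integrand hξ _))
    (fun _ ht => abs_integrand_pureDiff_three_le hξ y ν μ₀ hmax ht)
    (Cxi_pureDiff_eq_integral hξ y ν)

/-! ## 4. Sup-norm forms (|y|_∞ = `supNorm y`) and the second-order derivative bounds -/

/-- kernel: N³·e^{−N/2} ≤ 10.8 for N ≥ 0 (e·N/6 ≤ e^{N/6}, cubed; 216/e³ ≤ 10.8). [folklore] -/
private theorem cube_mul_exp_neg_half_le {N : ℝ} (hN : 0 ≤ N) : N ^ 3 * Real.exp (-(N / 2)) ≤ 10.8 := by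
  have h1 : Real.exp 1 * (N / 6) ≤ Real.exp (N / 6) := by
    have h := Real.add_one_le_exp (N / 6 - 1)
    rw [Real.exp_sub, le_div_iff₀ (Real.exp_pos 1)] at h
    linarith
  have h0 : 0 ≤ Real.exp 1 * (N / 6) := by positivity
  have h2 : (Real.exp 1 * (N / 6)) ^ 3 ≤ Real.exp (N / 6) ^ 3 := pow_le_pow_left₀ h0 h1 3
  have h3 : Real.exp (N / 6) ^ 3 = Real.exp (N / 2) := by rw [← Real.exp_nat_mul]; ring_nf
  rw [h3] at h2
  have h27 : (2.718 : ℝ) ≤ Real.exp 1 := (lt_trans (by norm_num) Real.exp_one_gt_d9).le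
  have he : (20 : ℝ) ≤ Real.exp 1 ^ 3 := le_trans (by norm_num) (pow_le_pow_left₀ (by norm_num) h27 3)
  have h4 : Real.exp 1 ^ 3 * N ^ 3 ≤ 216 * Real.exp (N / 2) := by nlinarith [h2]
  have h5 : N ^ 3 * Real.exp (-(N / 2)) * Real.exp 1 ^ 3 ≤ 216 := by
    rw [Real.exp_neg]
    have hpos := Real.exp_pos (N / 2)
    calc N ^ 3 * (Real.exp (N / 2))⁻¹ * Real.exp 1 ^ 3 = (Real.exp 1 ^ 3 * N ^ 3) / Real.exp (N / 2) := by
          field_simp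
      _ ≤ 216 * Real.exp (N / 2) / Real.exp (N / 2) := div_le_div_of_nonneg_right h4 hpos.le
      _ = 216 := by field_simp
  have hX0 : 0 ≤ N ^ 3 * Real.exp (-(N / 2)) := by positivity
  nlinarith [h5, he, hX0, mul_le_mul_of_nonneg_left he hX0]

/-- kernel (two length scales ⇒ sup norm): for 0 < ξ ≤ 1, 0 ≠ y ∈ ℤ³ and μ₀ a largest coordinate (N = |y_{μ₀}| = |y|_∞ ≥ 1,
N ≤ R, N² ≤ R²): ξ^{−1}[e^{−ξR/2}(29008/(R·R²) + 4480N/R⁴ + 10752N²/(R·R⁴)) + 1536e^{−N}] ≤ 61000·ξ^{−1}e^{−ξN/2}/N³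
(e^{−N} = e^{−N/2}e^{−N/2} ≤ e^{−ξN/2}·10.8/N³; 29008 + 4480 + 10752 + 16588.8 ≤ 61000). [cite: Balaban1983Higgs3, (2.10) p.426] -/
theorem twoScale_le_sup (hξ : 0 < ξ) (hξ1 : ξ ≤ 1) (y : ZSite 3) (hy : y ≠ 0) (μ₀ : Fin 3)
    (hmax : ∀ μ, (y μ).natAbs ≤ (y μ₀).natAbs) :
    ξ⁻¹ * (Real.exp (-(ξ * Real.sqrt (rsq y) / 2)) *
          (29008 / (Real.sqrt (rsq y) * rsq y) + 4480 * ((y μ₀).natAbs : ℝ) / (rsq y) ^ 2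
            + 10752 * ((y μ₀).natAbs : ℝ) ^ 2 / (Real.sqrt (rsq y) * (rsq y) ^ 2))
        + 1536 * Real.exp (-((y μ₀).natAbs : ℝ))) ≤
      61000 * ξ⁻¹ * Real.exp (-(ξ * ((y μ₀).natAbs : ℝ) / 2)) / ((y μ₀).natAbs : ℝ) ^ 3 := by
  have hR2 : Real.sqrt (rsq y) ^ 2 = rsq y := Real.sq_sqrt (rsq_nonneg y)
  set R := Real.sqrt (rsq y) with hRdef
  set N : ℝ := ((y μ₀).natAbs : ℝ) with hNdef
  have hN1 : 1 ≤ N := one_le_max y hy μ₀ hmax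
  have hN2 : N ^ 2 ≤ rsq y := sq_le_rsq y μ₀
  have hrsq : 0 < rsq y := by nlinarith
  have hRpos : 0 < R := Real.sqrt_pos.mpr hrsq
  have hNR : N ≤ R := by
    rw [hRdef]
    exact (Real.le_sqrt (by positivity) (rsq_nonneg y)).mpr hN2
  have hN0 : 0 < N := by linarith
  have hN3 : 0 < N ^ 3 := by positivity
  have hξinv : 0 < ξ⁻¹ := inv_pos.mpr hξ
  have hE1 : Real.exp (-(ξ * R / 2)) ≤ Real.exp (-(ξ * N / 2)) := Real.exp_le_exp.mpr (by nlinarith)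
  have hA : 29008 / (R * rsq y) ≤ 29008 / N ^ 3 := by
    refine div_le_div_of_nonneg_left (by norm_num) hN3 ?_
    calc N ^ 3 = N * N ^ 2 := by ring
      _ ≤ R * rsq y := mul_le_mul hNR hN2 (by positivity) hRpos.le
  have hB : 4480 * N / (rsq y) ^ 2 ≤ 4480 / N ^ 3 := by
    rw [div_le_div_iff₀ (by positivity) hN3]
    have h4 : N ^ 2 * N ^ 2 ≤ rsq y * rsq y := mul_le_mul hN2 hN2 (by positivity) hrsq.le
    nlinarith [h4]
  have hC : 10752 * N ^ 2 / (R * (rsq y) ^ 2) ≤ 10752 / N ^ 3 := by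
    rw [div_le_div_iff₀ (by positivity) hN3]
    have h5 : N * (N ^ 2 * N ^ 2) ≤ R * (rsq y * rsq y) :=
      mul_le_mul hNR (mul_le_mul hN2 hN2 (by positivity) hrsq.le) (by positivity) hRpos.le
    nlinarith [h5]
  have hD : 1536 * Real.exp (-N) ≤ 1536 * 10.8 * Real.exp (-(ξ * N / 2)) / N ^ 3 := by
    have e1 : Real.exp (-N) = Real.exp (-(N / 2)) * Real.exp (-(N / 2)) := by rw [← Real.exp_add]; ring_nf
    have e2 := cube_mul_exp_neg_half_le hN0.le
    have e3 : Real.exp (-(N / 2)) ≤ Real.exp (-(ξ * N / 2)) := Real.exp_le_exp.mpr (by nlinarith)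
    rw [le_div_iff₀ hN3, e1]
    calc 1536 * (Real.exp (-(N / 2)) * Real.exp (-(N / 2))) * N ^ 3
        = 1536 * Real.exp (-(N / 2)) * (N ^ 3 * Real.exp (-(N / 2))) := by ring
      _ ≤ 1536 * Real.exp (-(ξ * N / 2)) * 10.8 := by gcongr
      _ = 1536 * 10.8 * Real.exp (-(ξ * N / 2)) := by ring
  have hE : 0 ≤ Real.exp (-(ξ * R / 2)) := (Real.exp_pos _).le
  have hsum0 : 0 ≤ 29008 / N ^ 3 + 4480 / N ^ 3 + 10752 / N ^ 3 := by positivity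
  calc ξ⁻¹ * (Real.exp (-(ξ * R / 2)) * (29008 / (R * rsq y) + 4480 * N / (rsq y) ^ 2 + 10752 * N ^ 2 / (R * (rsq y) ^ 2))
        + 1536 * Real.exp (-N))
      ≤ ξ⁻¹ * (Real.exp (-(ξ * N / 2)) * (29008 / N ^ 3 + 4480 / N ^ 3 + 10752 / N ^ 3)
        + 1536 * 10.8 * Real.exp (-(ξ * N / 2)) / N ^ 3) := by
        refine mul_le_mul_of_nonneg_left (add_le_add ?_ hD) hξinv.le
        exact mul_le_mul hE1 (add_le_add (add_le_add hA hB) hC) (by positivity) (Real.exp_pos _).le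
    _ = 60828.8 * ξ⁻¹ * Real.exp (-(ξ * N / 2)) / N ^ 3 := by
        field_simp
        ring
    _ ≤ 61000 * ξ⁻¹ * Real.exp (-(ξ * N / 2)) / N ^ 3 := by gcongr; norm_num

/-- **The mixed second difference of C^ξ on ξℤ³, sup-norm form, uniformly in the lattice spacing**: for 0 < ξ ≤ 1, 0 ≠ y ∈ ℤ³,
ν ≠ ν′ and unit steps c, c′ ∈ {±1} of either sign,
|C^ξ(y+ce_ν+c′e_{ν′}) − C^ξ(y+ce_ν) − C^ξ(y+c′e_{ν′}) + C^ξ(y)| ≤ 61000·ξ^{−1}·e^{−ξ|y|_∞/2}/|y|_∞³. [cite: Balaban1983Higgs3, (2.10) p.426] -/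
theorem abs_Cxi_mixedDiff_le_sup (hξ : 0 < ξ) (hξ1 : ξ ≤ 1) (y : ZSite 3) (hy : y ≠ 0) {ν ν' : Fin 3} (hne : ν ≠ ν')
    {c c' : ℤ} (hc : c = 1 ∨ c = -1) (hc' : c' = 1 ∨ c' = -1) :
    |Cxi 3 ξ (y + c • unitVec ν + c' • unitVec ν') - Cxi 3 ξ (y + c • unitVec ν) - Cxi 3 ξ (y + c' • unitVec ν') + Cxi 3 ξ y| ≤
      61000 * ξ⁻¹ * Real.exp (-(ξ * supNorm y / 2)) / (supNorm y : ℝ) ^ 3 := by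
  obtain ⟨μ₀, hμ₀⟩ := exists_supNorm_eq y (by norm_num : 0 < 3)
  have hmax : ∀ μ, (y μ).natAbs ≤ (y μ₀).natAbs := fun μ => hμ₀ ▸ le_supNorm y μ
  rw [hμ₀]
  exact (abs_Cxi_mixedDiff_le_aux hξ y hy hne hc hc' μ₀ hmax).trans (twoScale_le_sup hξ hξ1 y hy μ₀ hmax)

/-- **The pure second difference of C^ξ on ξℤ³, sup-norm form**: for 0 < ξ ≤ 1, 0 ≠ y ∈ ℤ³ and every ν,
|C^ξ(y+e_ν) − 2C^ξ(y) + C^ξ(y−e_ν)| ≤ 61000·ξ^{−1}·e^{−ξ|y|_∞/2}/|y|_∞³. [cite: Balaban1983Higgs3, (2.10) p.426] -/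
theorem abs_Cxi_pureDiff_le_sup (hξ : 0 < ξ) (hξ1 : ξ ≤ 1) (y : ZSite 3) (hy : y ≠ 0) (ν : Fin 3) :
    |Cxi 3 ξ (y + unitVec ν) - 2 * Cxi 3 ξ y + Cxi 3 ξ (y - unitVec ν)| ≤
      61000 * ξ⁻¹ * Real.exp (-(ξ * supNorm y / 2)) / (supNorm y : ℝ) ^ 3 := by
  obtain ⟨μ₀, hμ₀⟩ := exists_supNorm_eq y (by norm_num : 0 < 3)
  have hmax : ∀ μ, (y μ).natAbs ≤ (y μ₀).natAbs := fun μ => hμ₀ ▸ le_supNorm y μ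
  rw [hμ₀]
  exact (abs_Cxi_pureDiff_le_aux hξ y hy ν μ₀ hmax).trans (twoScale_le_sup hξ hξ1 y hy μ₀ hmax)

/-- kernel: coordinates of a shifted site, (y + c·e_ν)_μ = y_μ + c·[μ = ν]. [folklore] -/
private theorem shift_apply (y : ZSite d) (ν μ : Fin d) (c : ℤ) :
    (y + c • unitVec ν) μ = y μ + if μ = ν then c else 0 := by
  by_cases h : μ = ν
  · subst h; simp [unitVec]
  · simp [unitVec, h]

/-- kernel: y − e_ν = y + (−1)·e_ν. [folklore] -/
private theorem sub_unitVec_eq (y : ZSite d) (ν : Fin d) : y - unitVec ν = y + (-1 : ℤ) • unitVec ν := by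
  funext μ
  rw [Pi.sub_apply, shift_apply]
  by_cases h : μ = ν
  · subst h; simp [unitVec]; omega
  · simp [unitVec, h]

/-- **(2.10) p. 426 at second order for the free propagator, mixed derivatives** (∂^ξ_{ν′}∂^ξ_ν = r15's `pdiffZ ξ⁻¹ ν'` ∘ `pdiffZ ξ⁻¹ ν`):
for 0 < ξ ≤ 1, 0 ≠ y ∈ ℤ³ and ν ≠ ν′, **|(∂^ξ_{ν′}∂^ξ_νC^ξ)(y)| ≤ 61000·e^{−ξ|y|_∞/2}/(ξ|y|_∞)³** — O(1)·d^{−3}e^{−½d} in the physical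
sup distance d = ξ|y|_∞, one factor d^{−1} per derivative beyond `B3CxiUniformBound.Cxi_three_le_sup`. [cite: Balaban1983Higgs3, (2.10) p.426] -/
theorem abs_pdiffZ_pdiffZ_Cxi_le_sup (hξ : 0 < ξ) (hξ1 : ξ ≤ 1) (y : ZSite 3) (hy : y ≠ 0) {ν ν' : Fin 3} (hne : ν ≠ ν') :
    |pdiffZ ξ⁻¹ ν' (pdiffZ ξ⁻¹ ν (Cxi 3 ξ)) y| ≤ 61000 * Real.exp (-(ξ * supNorm y / 2)) / (ξ * supNorm y) ^ 3 := by
  have h := abs_Cxi_mixedDiff_le_sup hξ hξ1 y hy hne.symm (c := 1) (c' := 1) (Or.inl rfl) (Or.inl rfl)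
  rw [one_smul, one_smul] at h
  have hξ' := hξ.ne'
  obtain ⟨μ₀, hμ₀⟩ := exists_supNorm_eq y (by norm_num : 0 < 3)
  have hmax : ∀ μ, (y μ).natAbs ≤ (y μ₀).natAbs := fun μ => hμ₀ ▸ le_supNorm y μ
  have hN1 : 1 ≤ ((supNorm y : ℕ) : ℝ) := by rw [hμ₀]; exact one_le_max y hy μ₀ hmax
  have hN' : ((supNorm y : ℕ) : ℝ) ≠ 0 := by linarith
  simp only [pdiffZ]
  have e : ξ⁻¹ * (ξ⁻¹ * (Cxi 3 ξ (y + unitVec ν' + unitVec ν) - Cxi 3 ξ (y + unitVec ν'))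
      - ξ⁻¹ * (Cxi 3 ξ (y + unitVec ν) - Cxi 3 ξ y)) =
      ξ⁻¹ ^ 2 * (Cxi 3 ξ (y + unitVec ν' + unitVec ν) - Cxi 3 ξ (y + unitVec ν') - Cxi 3 ξ (y + unitVec ν) + Cxi 3 ξ y) := by
    ring
  rw [e, abs_mul, abs_of_pos (by positivity)]
  calc ξ⁻¹ ^ 2 * |Cxi 3 ξ (y + unitVec ν' + unitVec ν) - Cxi 3 ξ (y + unitVec ν') - Cxi 3 ξ (y + unitVec ν) + Cxi 3 ξ y|
      ≤ ξ⁻¹ ^ 2 * (61000 * ξ⁻¹ * Real.exp (-(ξ * supNorm y / 2)) / (supNorm y : ℝ) ^ 3) :=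
        mul_le_mul_of_nonneg_left h (by positivity)
    _ = _ := by field_simp

/-- **(2.10) p. 426 at second order for the free propagator, ∂^{ξ*}_{ν′}∂^ξ_ν** (r15's `pdiffAdjZ ξ⁻¹ ν'` ∘ `pdiffZ ξ⁻¹ ν`; on the
diagonal ν′ = ν this is −ξ^{−2}[C^ξ(y+e_ν) − 2C^ξ(y) + C^ξ(y−e_ν)], the ν-th term of Δ^ξC^ξ up to sign; off the diagonal the mixed
difference with steps −e_{ν′}, +e_ν): for 0 < ξ ≤ 1, 0 ≠ y ∈ ℤ³ and all ν, ν′,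
**|(∂^{ξ*}_{ν′}∂^ξ_νC^ξ)(y)| ≤ 61000·e^{−ξ|y|_∞/2}/(ξ|y|_∞)³**. [cite: Balaban1983Higgs3, (2.10) p.426] -/
theorem abs_pdiffAdjZ_pdiffZ_Cxi_le_sup (hξ : 0 < ξ) (hξ1 : ξ ≤ 1) (y : ZSite 3) (hy : y ≠ 0) (ν ν' : Fin 3) :
    |pdiffAdjZ ξ⁻¹ ν' (pdiffZ ξ⁻¹ ν (Cxi 3 ξ)) y| ≤ 61000 * Real.exp (-(ξ * supNorm y / 2)) / (ξ * supNorm y) ^ 3 := by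
  have hξ' := hξ.ne'
  obtain ⟨μ₀, hμ₀⟩ := exists_supNorm_eq y (by norm_num : 0 < 3)
  have hmax : ∀ μ, (y μ).natAbs ≤ (y μ₀).natAbs := fun μ => hμ₀ ▸ le_supNorm y μ
  have hN1 : 1 ≤ ((supNorm y : ℕ) : ℝ) := by rw [hμ₀]; exact one_le_max y hy μ₀ hmax
  have hN' : ((supNorm y : ℕ) : ℝ) ≠ 0 := by linarith
  have key : |Cxi 3 ξ (y - unitVec ν' + unitVec ν) - Cxi 3 ξ (y - unitVec ν') - Cxi 3 ξ (y + unitVec ν) + Cxi 3 ξ y| ≤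
      61000 * ξ⁻¹ * Real.exp (-(ξ * supNorm y / 2)) / (supNorm y : ℝ) ^ 3 := by
    by_cases hne : ν' = ν
    · subst hne
      rw [sub_add_cancel]
      have h := abs_Cxi_pureDiff_le_sup hξ hξ1 y hy ν'
      rw [show Cxi 3 ξ y - Cxi 3 ξ (y - unitVec ν') - Cxi 3 ξ (y + unitVec ν') + Cxi 3 ξ y =
          -(Cxi 3 ξ (y + unitVec ν') - 2 * Cxi 3 ξ y + Cxi 3 ξ (y - unitVec ν')) by ring, abs_neg]
      exact h
    · have h := abs_Cxi_mixedDiff_le_sup hξ hξ1 y hy hne (c := -1) (c' := 1) (Or.inr rfl) (Or.inl rfl)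
      rw [one_smul, ← sub_unitVec_eq] at h
      exact h
  simp only [pdiffAdjZ, pdiffZ]
  have e : ξ⁻¹ * (ξ⁻¹ * (Cxi 3 ξ (y - unitVec ν' + unitVec ν) - Cxi 3 ξ (y - unitVec ν'))
      - ξ⁻¹ * (Cxi 3 ξ (y + unitVec ν) - Cxi 3 ξ y)) =
      ξ⁻¹ ^ 2 * (Cxi 3 ξ (y - unitVec ν' + unitVec ν) - Cxi 3 ξ (y - unitVec ν') - Cxi 3 ξ (y + unitVec ν) + Cxi 3 ξ y) := by
    ring
  rw [e, abs_mul, abs_of_pos (by positivity)]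
  calc ξ⁻¹ ^ 2 * |Cxi 3 ξ (y - unitVec ν' + unitVec ν) - Cxi 3 ξ (y - unitVec ν') - Cxi 3 ξ (y + unitVec ν) + Cxi 3 ξ y|
      ≤ ξ⁻¹ ^ 2 * (61000 * ξ⁻¹ * Real.exp (-(ξ * supNorm y / 2)) / (supNorm y : ℝ) ^ 3) :=
        mul_le_mul_of_nonneg_left key (by positivity)
    _ = _ := by field_simp

end

end Literature.MathematicalPhysics.QuantumFieldTheory.Balaban1983to89.B3CxiSecondDifferenceBound
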